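/-
Copyright (c) 2026 the pub-hodgecm-mathlib formalisation cell (harness21).  Prover seat hodgecm-mathlib-LH4-p16 (g2), req620 Track A «(D-RAM) FOUR-FRAME» squad
(STAGE-1b, row (2) of the piece `f_{T₊}`, the (β₂) road (R-36); β₂ sub-dealer LH4-p04 (g9) «= ROAD K5∕K6», target ‹CORE.letter.v1› (any `q`); MECH-K3 v1 §1:
K5-C, sixth file), 2026-09-05.
-/
import Summits.HodgeConjecture.HodgeConjecture.Theorems.F0P3cDyRamRowCellFibreTransport   -- ★ K5-C (5) (this seat): `trace_letters`, `dualGen_sub_map_eq`, the same-class transport; brings ★ K5-C (4), ★ p863246, ★ DEFS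
import HarnessLib

/-!
# Crux `H413`, line LH4 «(D-RAM) FOUR-FRAME» — STAGE-1b, row (2), the (β₂) road (R-36), (ROW-INT) ∕ ‹CORE›, K5-C (6): «FIBRES OVER ANY TWO POINTS OF THE CELL'S SPHERE ARE
# EQUINUMEROUS» — the transport across the TOP digit (`|κ₂ − κ₁| = |κ₁|` allowed), needed for `q = #𝓀 > 2`

Cell `hodgecm-mathlib` (D-0151), FLOOR 0, crux item H413 = `stmt-HodgeConjecture-24833`, route of record `HCCMUnconditional`; squad F0∕P3c∕LH4; lane
`--supports stmt-HodgeConjecture-24833 --as helper` (count-neutral; pays NO tier-0 row).  THEOREMS ONLY (no `def`, no instance, no notation, no `sorry`, default heartbeats);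
★-only imports; states NO law; (β₂) stays a HYPOTHESIS.  DATUM-FREE one-field letters as in ★ K5-C (5).
WHY (MECH-K3 v1 §1–§3 `F0/P3c/LH4/LH4-p16/g2/MECH-K3.v1.LH4p16g2.md`; sub-dealer 23:52:38Z «target ‹CORE.letter.v1› WHOLE» — every `q`).  ★ K5-C (5) moves a vertex between two digits
`κ₁, κ₂` with `|κ₂ − κ₁| < |κ₁|` — the same TOP digit — using ★ p863246's strict skew letter.  On the shells of the digit line (K₀ and the towers) there are `q − 1` top digits; at
`q = 2` (the frame of record) K5-C (5) is everything, for `q ≥ 4` the character sums of K6 (★ LH4-p14 `sum_normSign_affine_repr_*`) run over ALL unit residues, so the fibres must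
be compared ACROSS top digits too.  The strict letter fails there (`|N − ρN|·|Y| = |Y − ρY|`), but the transport still keeps the cell, for a finer reason: the new population
scalar is `t′ = t·(1 + τ)` with `|τ| < 1` EXACTLY (★ K5-C (4) `newTrace_eq` ∕ `trace_transport_eq`), so `t′` is a unit and `Y′ − ρY′ = t′·cc(α − ρα)` has the primitive size on
the nose.  THIS FILE: §1 `v_newPoint_sub_le_of_sphere` (★ K5-C (4)'s precision lemma with `|κ₂| = |κ₁|` in place of `|κ₂ − κ₁| < |κ₁|`), `isOrd_div_mul_of_skew_le` (the depth
clause under the NON-strict bound `|N − ρN|·|Y| ≤ |cc(α − ρα)|`); §2 HEADS `ncard_fibre_le_ncard_fibre_of_sphere` ∕ `ncard_fibre_eq_ncard_fibre_of_sphere` — same fibres, same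
letters as ★ K5-C (5) (plus `|ϖE| < 1`), hypothesis `|κ₂| = |κ₁|` only: ANY two points of the cell's sphere in one `Q`-class carry equinumerous fibres.
WHAT IS NOT CLAIMED: realisability of `ρκ₂∕ρκ₁` as `εΘε` (★ p863223's class test), which top digits a cell occupies, any census identity.
HONEST LABEL.  Count-neutral lattice bookkeeping; nothing printed is asserted; no census law is stated; `HC_CM` is proved only modulo the 7 printed citations (2 remaining named inputs:
hLiu418 = `stmt-HodgeConjecture-24832`, h413 = `stmt-HodgeConjecture-24833`) until rung 0 closes.
## References
* [Jacobowitz1962] R. Jacobowitz, *Hermitian forms over local fields*, Amer. J. Math. 84 (1962): §4.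
* [Kottwitz1986BaseChangeUnits] R. E. Kottwitz, *Base change for unit elements of Hecke algebras*, Compositio Math. 60 (1986): §1 pp. 240–241.
* [Flicker1998UnitaryFL] Y. Z. Flicker, *Elementary proof of the fundamental lemma for a unitary group*, Canad. J. Math. 50 (1998): Prop. 7 p. 84.
* [Serre1979] J.-P. Serre, *Local Fields*, GTM 67 (1979): Ch. III §6 Prop. 12, Ch. V §3 Cor. 3.
-/

set_option autoImplicit false

noncomputable section

namespace Summit.HodgeConjecture.HodgeConjecture.Cruxes.H413.F0P3cDyRamRowCellSphereTransport

open scoped Valued WithZero Pointwise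
open WithZero
open Summit.HodgeConjecture.HodgeConjecture.Cruxes.H413.F0P3cDyRamToricCensusDefs
open Summit.HodgeConjecture.HodgeConjecture.Cruxes.H413.F0P3cDyRamConeCellLabelBalance (dualGen_mul_left)
open Summit.HodgeConjecture.HodgeConjecture.Cruxes.H413.F0P3cDyRamRowCellDigitTransport
open Summit.HodgeConjecture.HodgeConjecture.Cruxes.H413.F0P3cDyRamRowCellFibreTransport (dualGen_sub_map_eq trace_letters)

variable {K : Type} [Field K] [Valued K ℤᵐ⁰] {ρ Θ : K →+* K} {α : K}

/-! ## §1 The precision lemma on a sphere; the depth clause under the non-strict bound -/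

/-- **THE TRANSPORT LOSES NO PRECISION (sphere version).**  `κ₁, κ₂, κ̂` on the line, `κ₁ ≠ 0`, **`|κ₂| = |κ₁|`**, `|κ̂ − κ₁| < |κ₁|` ⟹ `|τ| < 1`, `|Tr_ρ(κ₂κ̂∕κ₁)| = 1`,
`|κ̂′ − κ₂| ≤ |κ̂ − κ₁|` (`τ`, `κ̂′` as in ★ K5-C (4)). [cite: Serre1979, Ch. III §6 Prop. 12] [cite: Kottwitz1986BaseChangeUnits, §1 pp. 240–241] -/
theorem v_newPoint_sub_le_of_sphere (hvρ : ∀ x, Valued.v (ρ x) = Valued.v x) {κ₁ κ₂ κ : K} (h₁ : κ₁ + ρ κ₁ = 1) (h₂ : κ₂ + ρ κ₂ = 1)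
    (hκ : κ + ρ κ = 1) (hκ₁ : κ₁ ≠ 0) (hκ₂v : Valued.v κ₂ = Valued.v κ₁) (hκκ : Valued.v (κ - κ₁) < Valued.v κ₁) :
    Valued.v ((κ₂ - κ₁) * (κ - κ₁) / (κ₁ * ρ κ₁)) < 1 ∧ Valued.v (κ₂ * κ / κ₁ + ρ (κ₂ * κ / κ₁)) = 1 ∧
      Valued.v (κ₂ * κ / κ₁ / (κ₂ * κ / κ₁ + ρ (κ₂ * κ / κ₁)) - κ₂) ≤ Valued.v (κ - κ₁) := by
  have hvκ₁ : Valued.v κ₁ ≠ 0 := (Valuation.ne_zero_iff _).2 hκ₁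
  have hpos : (0 : ℤᵐ⁰) < Valued.v κ₁ := zero_lt_iff.2 hvκ₁
  have hρκ₁ : ρ κ₁ ≠ 0 := (map_ne_zero ρ).2 hκ₁
  have hΔle : Valued.v (κ₂ - κ₁) ≤ Valued.v κ₁ := (Valuation.map_sub _ _ _).trans (max_le hκ₂v.le le_rfl)
  set τ : K := (κ₂ - κ₁) * (κ - κ₁) / (κ₁ * ρ κ₁) with hτdef
  have hτv : Valued.v τ = Valued.v (κ₂ - κ₁) * Valued.v (κ - κ₁) / Valued.v κ₁ ^ 2 := v_tau_eq hvρ κ₁ κ₂ κ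
  have hτlt : Valued.v τ < 1 := by
    rw [hτv, div_lt_one₀ (pow_pos hpos 2), pow_two]
    exact mul_lt_mul' hΔle hκκ zero_le hpos
  have hT : κ₂ * κ / κ₁ + ρ (κ₂ * κ / κ₁) = 1 + τ := trace_transport_eq h₁ h₂ hκ hκ₁ hρκ₁
  have h1τ : Valued.v (1 + τ) = 1 := by rw [Valuation.map_add_eq_of_lt_left _ (by rwa [Valuation.map_one]), Valuation.map_one]
  have h1τ0 : 1 + τ ≠ 0 := fun h0 => by rw [h0, map_zero] at h1τ; exact zero_ne_one h1τ
  refine ⟨hτlt, by rw [hT, h1τ], ?_⟩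
  rw [hT, newPoint_sub_eq hκ₁ h1τ0, map_div₀, h1τ, div_one, Valuation.map_mul, hκ₂v]
  have hC : Valued.v κ₁ * Valued.v τ ≤ Valued.v (κ - κ₁) := by
    rw [hτv, pow_two, mul_comm (Valued.v κ₁), div_mul_eq_mul_div, mul_div_mul_right _ _ hvκ₁, div_le_iff₀ hpos]
    calc Valued.v (κ₂ - κ₁) * Valued.v (κ - κ₁) ≤ Valued.v κ₁ * Valued.v (κ - κ₁) := mul_le_mul' hΔle le_rfl
      _ = Valued.v (κ - κ₁) * Valued.v κ₁ := mul_comm _ _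
  calc Valued.v κ₁ * Valued.v ((κ - κ₁) / κ₁ - τ) ≤ Valued.v κ₁ * max (Valued.v ((κ - κ₁) / κ₁)) (Valued.v τ) :=
        mul_le_mul' le_rfl (Valuation.map_sub _ _ _)
    _ = max (Valued.v κ₁ * Valued.v ((κ - κ₁) / κ₁)) (Valued.v κ₁ * Valued.v τ) := (max_mul_mul_left _ _ _).symm
    _ ≤ Valued.v (κ - κ₁) := max_le (le_of_eq (by rw [map_div₀, ← mul_div_assoc, mul_div_cancel_left₀ _ hvκ₁])) hC

/-- **THE DEPTH CLAUSE UNDER THE NON-STRICT BOUND**: `μ∕Y ∈ 𝒪_cc`, `|μ| ≤ |Y|²`, `|N| = 1`, `|N − ρN|·|Y| ≤ |cc(α − ρα)|` ⟹ `μ∕(N·Y) ∈ 𝒪_cc`.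
[cite: Kottwitz1986BaseChangeUnits, §1 pp. 240–241] [cite: Serre1979, Ch. III §6 Prop. 12] -/
theorem isOrd_div_mul_of_skew_le (hvρ : ∀ x, Valued.v (ρ x) = Valued.v x) {N Y μ cc : K} (hN1 : Valued.v N = 1)
    (hNY : Valued.v (N - ρ N) * Valued.v Y ≤ Valued.v (cc * (α - ρ α))) (hμY : Valued.v μ ≤ Valued.v Y ^ 2)
    (hP : IsOrd ρ α cc (μ / Y)) : IsOrd ρ α cc (μ / (N * Y)) := by
  have hN0 : N ≠ 0 := fun h0 => by rw [h0, map_zero] at hN1; exact zero_ne_one hN1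
  have hρN0 : ρ N ≠ 0 := (map_ne_zero ρ).2 hN0
  have hρN1 : Valued.v (ρ N) = 1 := by rw [hvρ, hN1]
  by_cases hY0 : Y = 0
  · rw [hY0, mul_zero, div_zero]; rw [hY0, div_zero] at hP; exact hP
  have hvY0 : Valued.v Y ≠ 0 := (Valuation.ne_zero_iff _).2 hY0
  refine ⟨?_, ?_⟩
  · rw [map_div₀, Valuation.map_mul, hN1, one_mul, ← map_div₀]; exact hP.1
  · have e : μ / (N * Y) - ρ (μ / (N * Y)) = ((μ / Y - ρ (μ / Y)) * ρ N + ρ (μ / Y) * (ρ N - N)) / (N * ρ N) := by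
      rw [map_div₀, map_mul, map_div₀]; field_simp; ring
    rw [e, map_div₀, Valuation.map_mul, hN1, hρN1, mul_one, div_one]
    refine (Valuation.map_add _ _ _).trans (max_le ?_ ?_)
    · rw [Valuation.map_mul, hρN1, mul_one]; exact hP.2
    · rw [Valuation.map_mul, hvρ, ← Valuation.map_neg _ (ρ N - N), neg_sub, map_div₀]
      have h2 : Valued.v μ / Valued.v Y ≤ Valued.v Y := by
        rw [div_le_iff₀ (zero_lt_iff.2 hvY0), ← pow_two]; exact hμY
      calc Valued.v μ / Valued.v Y * Valued.v (N - ρ N) ≤ Valued.v Y * Valued.v (N - ρ N) := mul_le_mul' h2 le_rfl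
        _ = Valued.v (N - ρ N) * Valued.v Y := mul_comm _ _
        _ ≤ Valued.v (cc * (α - ρ α)) := hNY

/-! ## §2 HEADS — transport across the top digit -/

/-- **HEAD — «FIBRES OVER ANY TWO POINTS OF THE CELL'S SPHERE ARE EQUINUMEROUS» (injection half).**  ★ K5-C (5)'s fibres and letters, with `|ϖE| < 1` and **`|κ₂| = |κ₁|`** in place of
`|κ₂ − κ₁| < |κ₁|`: `Λ ↦ ε • Λ` (`εΘε = ρκ₂∕ρκ₁`) injects fibre(P, κ₁) into fibre(P, κ₂); the cell is kept because the new population scalar `t′ = t(1 + τ)`, `|τ| < 1`, is a unit,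
so `Y′ − ρY′ = t′·cc(α − ρα)` has the primitive size. [cite: Kottwitz1986BaseChangeUnits, §1 pp. 240–241] [cite: Flicker1998UnitaryFL, Prop. 7 p. 84] [cite: Jacobowitz1962, §4] -/
theorem ncard_fibre_le_ncard_fibre_of_sphere (hρρ : ∀ x, ρ (ρ x) = x) (hvρ : ∀ x, Valued.v (ρ x) = Valued.v x) (hΘΘ : ∀ x, Θ (Θ x) = x)
    (hΘρ : ∀ x, Θ (ρ x) = ρ (Θ x))
    {h ϖE μ : K} (hΘh : Θ h = h) (hρϖ : ρ ϖE = ϖE) (hϖ0 : ϖE ≠ 0) (hϖlt : Valued.v ϖE < 1) {j a : ℕ} (ha1 : 1 ≤ a)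
    (hcc : ϖE ^ j * (α - ρ α) ≠ 0)
    (hμ : Valued.v μ ≤ (Valued.v ϖE ^ a) ^ 2)
    (hFgap : ∀ z : K, ρ z = z → Θ z = z → Valued.v ϖE < Valued.v z → Valued.v z ≤ 1 → Valued.v z = 1)
    {r₀ : ℤᵐ⁰} (hdeep : ∀ u : K, ρ u = u → Θ u = u → Valued.v (u - 1) ≤ r₀ → ∃ c : K, ρ c = c ∧ c * Θ c = u)
    {κ₁ κ₂ : K} (hκ₁ : κ₁ + ρ κ₁ = 1) (hκ₂ : κ₂ + ρ κ₂ = 1) (hΘκ₁ : Θ κ₁ = κ₁) (hΘκ₂ : Θ κ₂ = κ₂)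
    (hR : Valued.v κ₁ * Valued.v (ϖE ^ j * (α - ρ α)) = Valued.v ϖE ^ a) (hκ₂v : Valued.v κ₂ = Valued.v κ₁)
    {r : ℤᵐ⁰} (hr : r < Valued.v κ₁) (hrτ : Valued.v (κ₂ - κ₁) * r ≤ r₀ * Valued.v κ₁ ^ 2)
    {ε : K} (hε : ε * Θ ε = ρ κ₂ / ρ κ₁) (P : Prop) (hfin : (levelSet ρ Θ α ϖE h j a).Finite) :
    {Λ : AddSubgroup K | ∃ x₀ : K, x₀ ≠ 0 ∧ (∀ x, x ∈ Λ ↔ ∃ ζ, IsOrd ρ α (ϖE ^ j) ζ ∧ x = x₀ * ζ) ∧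
        IsOrd ρ α (ϖE ^ j) (dualGen ρ Θ α (ϖE ^ j) h x₀) ∧ ¬ IsOrd ρ α (ϖE ^ j) (dualGen ρ Θ α (ϖE ^ j) h x₀ / ϖE) ∧
        Valued.v (dualGen ρ Θ α (ϖE ^ j) h x₀) = Valued.v ϖE ^ a ∧ IsOrd ρ α (ϖE ^ j) (μ / dualGen ρ Θ α (ϖE ^ j) h x₀) ∧
        ((∃ c : K, ρ c = c ∧ c * Θ c = h * (x₀ * Θ x₀) + ρ (h * (x₀ * Θ x₀))) ↔ P) ∧
        Valued.v (ρ (h * (x₀ * Θ x₀)) / (h * (x₀ * Θ x₀) + ρ (h * (x₀ * Θ x₀))) - κ₁) ≤ r}.ncard ≤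
      {Λ : AddSubgroup K | ∃ x₀ : K, x₀ ≠ 0 ∧ (∀ x, x ∈ Λ ↔ ∃ ζ, IsOrd ρ α (ϖE ^ j) ζ ∧ x = x₀ * ζ) ∧
        IsOrd ρ α (ϖE ^ j) (dualGen ρ Θ α (ϖE ^ j) h x₀) ∧ ¬ IsOrd ρ α (ϖE ^ j) (dualGen ρ Θ α (ϖE ^ j) h x₀ / ϖE) ∧
        Valued.v (dualGen ρ Θ α (ϖE ^ j) h x₀) = Valued.v ϖE ^ a ∧ IsOrd ρ α (ϖE ^ j) (μ / dualGen ρ Θ α (ϖE ^ j) h x₀) ∧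
        ((∃ c : K, ρ c = c ∧ c * Θ c = h * (x₀ * Θ x₀) + ρ (h * (x₀ * Θ x₀))) ↔ P) ∧
        Valued.v (ρ (h * (x₀ * Θ x₀)) / (h * (x₀ * Θ x₀) + ρ (h * (x₀ * Θ x₀))) - κ₂) ≤ r}.ncard := by
  classical
  -- letters
  have hvϖ0 : Valued.v ϖE ≠ 0 := (Valuation.ne_zero_iff _).2 hϖ0
  have hvκ₁ : Valued.v κ₁ ≠ 0 := fun h0 => by rw [h0, zero_mul] at hR; exact pow_ne_zero _ hvϖ0 hR.symm
  have hpos₁ : (0 : ℤᵐ⁰) < Valued.v κ₁ := zero_lt_iff.2 hvκ₁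
  have hκ₁0 : κ₁ ≠ 0 := (Valuation.ne_zero_iff _).1 hvκ₁
  have hccpos : (0 : ℤᵐ⁰) < Valued.v (ϖE ^ j * (α - ρ α)) := zero_lt_iff.2 ((Valuation.ne_zero_iff _).2 hcc)
  have hρcc : ρ (ϖE ^ j) = ϖE ^ j := by rw [map_pow, hρϖ]
  have hϖ1 : Valued.v ϖE ≤ 1 := hϖlt.le
  have hΔle : Valued.v (κ₂ - κ₁) ≤ Valued.v κ₁ := (Valuation.map_sub _ _ _).trans (max_le hκ₂v.le le_rfl)
  -- the multiplier `N = ρκ₂∕ρκ₁ = εΘε`: a unit with skew `|κ₂ − κ₁|∕|κ₁|²`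
  have hN1 : Valued.v (ε * Θ ε) = 1 := by
    rw [hε, map_div₀, hvρ, hvρ, hκ₂v, div_self hvκ₁]
  have hε0 : ε ≠ 0 := fun h0 => by rw [h0, zero_mul, map_zero] at hN1; exact zero_ne_one hN1
  -- the map `Λ ↦ ε • Λ`, injective, into a finite set
  refine Set.ncard_le_ncard_of_injOn (fun Λ => ε • Λ) (fun Λ hΛ => ?_) (fun Λ₁ _ Λ₂ _ h12' => by
      have := congrArg (fun Λ => ε⁻¹ • Λ) h12'
      simpa only [smul_smul, inv_mul_cancel₀ hε0, one_smul] using this)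
    (hfin.subset fun Λ ⟨x₀, hx₀, hmem, hyO, hyprim, hylev, _, _, _⟩ => ⟨x₀, hx₀, hmem, hyO, hyprim, hylev⟩)
  obtain ⟨x₀, hx₀, hmem, hyO, hyprim, hylev, hdep, hcls, hdig⟩ := hΛ
  -- the old vertex: `u₀`, `t`, `κ̂`
  obtain ⟨hρt, hΘt, ht1⟩ := trace_letters (α := α) hρρ hΘΘ hΘρ hΘh hρϖ hϖ0 hϖ1 ha1 hcc hFgap hyO hyprim hylev
  set u₀ : K := h * (x₀ * Θ x₀) with hu₀def
  set t : K := u₀ + ρ u₀ with htdef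
  set κ : K := ρ u₀ / t with hκdef
  have ht0 : t ≠ 0 := fun h0 => by rw [h0, map_zero] at ht1; exact zero_ne_one ht1
  have hΘu : Θ u₀ = u₀ := by rw [hu₀def, map_mul, map_mul, hΘh, hΘΘ]; ring
  have hY : dualGen ρ Θ α (ϖE ^ j) h x₀ = u₀ * (ϖE ^ j * (α - ρ α)) := by rw [dualGen_def]
  have hu₀v : Valued.v u₀ = Valued.v κ₁ := by
    have h1 := hylev; rw [hY, Valuation.map_mul, ← hR] at h1
    exact mul_right_cancel₀ ((Valuation.ne_zero_iff _).2 hcc) h1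
  have hκtr : κ + ρ κ = 1 := by rw [hκdef, map_div₀, hρρ, hρt, ← add_div, htdef, add_comm, div_self ht0]
  have hΘκ : Θ κ = κ := by rw [hκdef, map_div₀, hΘρ, hΘu, hΘt]
  have hκv : Valued.v κ = Valued.v κ₁ := by rw [hκdef, map_div₀, hvρ, hu₀v, ht1, div_one]
  have hκκ : Valued.v (κ - κ₁) < Valued.v κ₁ := lt_of_le_of_lt hdig hr
  have hu₀eq : u₀ = t * ρ κ := eq_trace_mul_map_point hρρ ht0
  -- the new vertex over `ε·x₀`
  have hdg : dualGen ρ Θ α (ϖE ^ j) h (ε * x₀) = (ε * Θ ε) * dualGen ρ Θ α (ϖE ^ j) h x₀ := dualGen_mul_left _ _ _ _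
  have hu' : h * (ε * x₀ * Θ (ε * x₀)) = ρ κ₂ / ρ κ₁ * (t * ρ κ) := by
    rw [← hε, ← hu₀eq, hu₀def, map_mul]; ring
  obtain ⟨hτlt, hTr1, hnew⟩ := v_newPoint_sub_le_of_sphere hvρ hκ₁ hκ₂ hκtr hκ₁0 hκ₂v hκκ
  have hρκ₁0 : ρ κ₁ ≠ 0 := (map_ne_zero ρ).2 hκ₁0
  have hTr : κ₂ * κ / κ₁ + ρ (κ₂ * κ / κ₁) = 1 + (κ₂ - κ₁) * (κ - κ₁) / (κ₁ * ρ κ₁) := trace_transport_eq hκ₁ hκ₂ hκtr hκ₁0 hρκ₁0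
  set τ : K := (κ₂ - κ₁) * (κ - κ₁) / (κ₁ * ρ κ₁) with hτdef
  have hTr0 : κ₂ * κ / κ₁ + ρ (κ₂ * κ / κ₁) ≠ 0 := fun h0 => by rw [h0, map_zero] at hTr1; exact zero_ne_one hTr1
  -- its population scalar `t′ = t·(1 + τ)` and digit `κ̂′`
  have ht' : h * (ε * x₀ * Θ (ε * x₀)) + ρ (h * (ε * x₀ * Θ (ε * x₀))) = t * (1 + τ) := by rw [hu', newTrace_eq hρρ hρt, hTr]
  have hκ' : ρ (h * (ε * x₀ * Θ (ε * x₀))) / (h * (ε * x₀ * Θ (ε * x₀)) + ρ (h * (ε * x₀ * Θ (ε * x₀)))) =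
      κ₂ * κ / κ₁ / (κ₂ * κ / κ₁ + ρ (κ₂ * κ / κ₁)) := by rw [hu']; exact newPoint_eq hρρ hρt ht0
  have ht'1 : Valued.v (h * (ε * x₀ * Θ (ε * x₀)) + ρ (h * (ε * x₀ * Θ (ε * x₀)))) = 1 := by
    rw [ht', Valuation.map_mul, ht1, one_mul, ← hTr, hTr1]
  have hY'sk : Valued.v (dualGen ρ Θ α (ϖE ^ j) h (ε * x₀) - ρ (dualGen ρ Θ α (ϖE ^ j) h (ε * x₀))) = Valued.v (ϖE ^ j * (α - ρ α)) := by
    rw [dualGen_sub_map_eq (Θ := Θ) (α := α) hρρ hρcc, Valuation.map_mul, ht'1, one_mul]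
  have hY'v : Valued.v (dualGen ρ Θ α (ϖE ^ j) h (ε * x₀)) = Valued.v ϖE ^ a := by rw [hdg, Valuation.map_mul, hN1, one_mul, hylev]
  have hNsk : Valued.v (ε * Θ ε - ρ (ε * Θ ε)) = Valued.v (κ₂ - κ₁) / Valued.v κ₁ ^ 2 := by
    rw [hε]; exact v_transportMul_sub_map_eq hρρ hvρ hκ₁ hκ₂ hκ₁0
  have hNY : Valued.v (ε * Θ ε - ρ (ε * Θ ε)) * Valued.v (dualGen ρ Θ α (ϖE ^ j) h x₀) ≤ Valued.v (ϖE ^ j * (α - ρ α)) := by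
    rw [hNsk, hY, Valuation.map_mul, hu₀v, pow_two, div_mul_eq_mul_div,
      show Valued.v (κ₂ - κ₁) * (Valued.v κ₁ * Valued.v (ϖE ^ j * (α - ρ α))) = Valued.v (κ₂ - κ₁) * Valued.v (ϖE ^ j * (α - ρ α)) * Valued.v κ₁ by
        rw [mul_comm (Valued.v κ₁), mul_assoc],
      mul_div_mul_right _ _ hvκ₁, div_le_iff₀ hpos₁, mul_comm (Valued.v (ϖE ^ j * (α - ρ α))) (Valued.v κ₁)]
    exact mul_le_mul' hΔle le_rfl
  -- `1 + τ` is a doubly-fixed unit `≡ 1` to depth `r₀`, hence a `Θ`-norm of a `ρ`-fixed element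
  have hρτ : ρ τ = τ := map_tau_eq hρρ hκ₁ hκ₂ hκtr
  have hΘτ : Θ τ = τ := mapTheta_tau_eq hΘρ hΘκ₁ hΘκ₂ hΘκ
  have hτr : Valued.v τ ≤ r₀ := by
    rw [hτdef, v_tau_eq hvρ, div_le_iff₀ (pow_pos hpos₁ 2)]
    exact (mul_le_mul' le_rfl hdig).trans hrτ
  obtain ⟨c, hρc, hc⟩ := hdeep (1 + τ) (by rw [map_add, map_one, hρτ]) (by rw [map_add, map_one, hΘτ]) (by rw [add_sub_cancel_left]; exact hτr)
  have hc0 : c ≠ 0 := fun h0 => by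
    rw [h0, zero_mul] at hc; rw [hTr, ← hc, map_zero] at hTr1; exact zero_ne_one hTr1
  -- assemble the membership of `ε • Λ`
  refine ⟨ε * x₀, mul_ne_zero hε0 hx₀, fun x => ?_, ?_, ?_, ?_, ?_, ?_, ?_⟩
  · rw [AddSubgroup.mem_smul_pointwise_iff_exists]
    constructor
    · rintro ⟨s, hs, rfl⟩
      obtain ⟨z, hz, rfl⟩ := (hmem s).1 hs
      exact ⟨z, hz, by rw [smul_eq_mul, mul_assoc]⟩
    · rintro ⟨z, hz, rfl⟩
      exact ⟨x₀ * z, (hmem _).2 ⟨z, hz, rfl⟩, by rw [smul_eq_mul, mul_assoc]⟩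
  · refine ⟨?_, by rw [hY'sk]⟩
    rw [hY'v, ← hylev]; exact hyO.1
  · rintro ⟨-, h2⟩
    rw [map_div₀, hρϖ, ← sub_div, map_div₀, hY'sk, div_le_iff₀ (zero_lt_iff.2 hvϖ0)] at h2
    have hlt : Valued.v (ϖE ^ j * (α - ρ α)) * Valued.v ϖE < Valued.v (ϖE ^ j * (α - ρ α)) * 1 := mul_lt_mul_of_pos_left hϖlt hccpos
    rw [mul_one] at hlt
    exact absurd h2 (not_le.2 hlt)
  · exact hY'v
  · rw [hdg]
    exact isOrd_div_mul_of_skew_le hvρ hN1 hNY (by rw [hylev]; exact hμ) hdep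
  · -- the class of `t′ = t·(1 + τ)`
    rw [ht', ← hcls]
    constructor
    · rintro ⟨c', hρc', hc'⟩
      refine ⟨c' / c, by rw [map_div₀, hρc', hρc], ?_⟩
      rw [map_div₀, div_mul_div_comm, hc', hc, mul_div_assoc, div_self (by rw [← hTr]; exact hTr0), mul_one]
    · rintro ⟨c', hρc', hc'⟩
      exact ⟨c' * c, by rw [map_mul, hρc', hρc], by rw [map_mul, ← hc', ← hc]; ring⟩
  · -- the digit of the new vertex
    rw [hκ']
    exact hnew.trans hdig


/-- **HEAD′ — equality.**  With `ε⁻¹` the other way (the letters are symmetric under `κ₁ ↔ κ₂`): `#fibre(P, κ₁) = #fibre(P, κ₂)` for ANY two points of the cell's sphere in one `Q`-class.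
[cite: Kottwitz1986BaseChangeUnits, §1 pp. 240–241] [cite: Flicker1998UnitaryFL, Prop. 7 p. 84] -/
theorem ncard_fibre_eq_ncard_fibre_of_sphere (hρρ : ∀ x, ρ (ρ x) = x) (hvρ : ∀ x, Valued.v (ρ x) = Valued.v x) (hΘΘ : ∀ x, Θ (Θ x) = x)
    (hΘρ : ∀ x, Θ (ρ x) = ρ (Θ x))
    {h ϖE μ : K} (hΘh : Θ h = h) (hρϖ : ρ ϖE = ϖE) (hϖ0 : ϖE ≠ 0) (hϖlt : Valued.v ϖE < 1) {j a : ℕ} (ha1 : 1 ≤ a)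
    (hcc : ϖE ^ j * (α - ρ α) ≠ 0)
    (hμ : Valued.v μ ≤ (Valued.v ϖE ^ a) ^ 2)
    (hFgap : ∀ z : K, ρ z = z → Θ z = z → Valued.v ϖE < Valued.v z → Valued.v z ≤ 1 → Valued.v z = 1)
    {r₀ : ℤᵐ⁰} (hdeep : ∀ u : K, ρ u = u → Θ u = u → Valued.v (u - 1) ≤ r₀ → ∃ c : K, ρ c = c ∧ c * Θ c = u)
    {κ₁ κ₂ : K} (hκ₁ : κ₁ + ρ κ₁ = 1) (hκ₂ : κ₂ + ρ κ₂ = 1) (hΘκ₁ : Θ κ₁ = κ₁) (hΘκ₂ : Θ κ₂ = κ₂)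
    (hR : Valued.v κ₁ * Valued.v (ϖE ^ j * (α - ρ α)) = Valued.v ϖE ^ a) (hκ₂v : Valued.v κ₂ = Valued.v κ₁)
    {r : ℤᵐ⁰} (hr : r < Valued.v κ₁) (hrτ : Valued.v (κ₂ - κ₁) * r ≤ r₀ * Valued.v κ₁ ^ 2)
    {ε : K} (hε : ε * Θ ε = ρ κ₂ / ρ κ₁) (P : Prop) (hfin : (levelSet ρ Θ α ϖE h j a).Finite) :
    {Λ : AddSubgroup K | ∃ x₀ : K, x₀ ≠ 0 ∧ (∀ x, x ∈ Λ ↔ ∃ ζ, IsOrd ρ α (ϖE ^ j) ζ ∧ x = x₀ * ζ) ∧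
        IsOrd ρ α (ϖE ^ j) (dualGen ρ Θ α (ϖE ^ j) h x₀) ∧ ¬ IsOrd ρ α (ϖE ^ j) (dualGen ρ Θ α (ϖE ^ j) h x₀ / ϖE) ∧
        Valued.v (dualGen ρ Θ α (ϖE ^ j) h x₀) = Valued.v ϖE ^ a ∧ IsOrd ρ α (ϖE ^ j) (μ / dualGen ρ Θ α (ϖE ^ j) h x₀) ∧
        ((∃ c : K, ρ c = c ∧ c * Θ c = h * (x₀ * Θ x₀) + ρ (h * (x₀ * Θ x₀))) ↔ P) ∧
        Valued.v (ρ (h * (x₀ * Θ x₀)) / (h * (x₀ * Θ x₀) + ρ (h * (x₀ * Θ x₀))) - κ₁) ≤ r}.ncard =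
      {Λ : AddSubgroup K | ∃ x₀ : K, x₀ ≠ 0 ∧ (∀ x, x ∈ Λ ↔ ∃ ζ, IsOrd ρ α (ϖE ^ j) ζ ∧ x = x₀ * ζ) ∧
        IsOrd ρ α (ϖE ^ j) (dualGen ρ Θ α (ϖE ^ j) h x₀) ∧ ¬ IsOrd ρ α (ϖE ^ j) (dualGen ρ Θ α (ϖE ^ j) h x₀ / ϖE) ∧
        Valued.v (dualGen ρ Θ α (ϖE ^ j) h x₀) = Valued.v ϖE ^ a ∧ IsOrd ρ α (ϖE ^ j) (μ / dualGen ρ Θ α (ϖE ^ j) h x₀) ∧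
        ((∃ c : K, ρ c = c ∧ c * Θ c = h * (x₀ * Θ x₀) + ρ (h * (x₀ * Θ x₀))) ↔ P) ∧
        Valued.v (ρ (h * (x₀ * Θ x₀)) / (h * (x₀ * Θ x₀) + ρ (h * (x₀ * Θ x₀))) - κ₂) ≤ r}.ncard := by
  have h21v : Valued.v (κ₁ - κ₂) = Valued.v (κ₂ - κ₁) := by rw [← Valuation.map_neg, neg_sub]
  refine le_antisymm
    (ncard_fibre_le_ncard_fibre_of_sphere hρρ hvρ hΘΘ hΘρ hΘh hρϖ hϖ0 hϖlt ha1 hcc hμ hFgap hdeep hκ₁ hκ₂ hΘκ₁ hΘκ₂ hR hκ₂v hr hrτ hε P hfin)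
    (ncard_fibre_le_ncard_fibre_of_sphere hρρ hvρ hΘΘ hΘρ hΘh hρϖ hϖ0 hϖlt ha1 hcc hμ hFgap hdeep hκ₂ hκ₁ hΘκ₂ hΘκ₁ (by rw [hκ₂v]; exact hR)
      hκ₂v.symm (by rw [hκ₂v]; exact hr) (by rw [h21v, hκ₂v]; exact hrτ) (ε := ε⁻¹) ?_ P hfin)
  rw [map_inv₀, ← mul_inv, hε, inv_div]

end Summit.HodgeConjecture.HodgeConjecture.Cruxes.H413.F0P3cDyRamRowCellSphereTransport

end
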